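import Summits.Ventures.HSemireg.WedgeHankelRecurrenceGaussHermiteDiscriminant

/-!
# Venture HSemireg — **RESULTANTS OF CONSECUTIVE CHEBYSHEV POLYNOMIALS** (Schur's recursion for the NON-monic recurrence `P_{n+2} = 2X P_{n+1} − P_n`, leading coefficients `2^n`):
# **`Res(T_{n+1}, T_n) = (−1)^{n(n+1)∕2} 2^{n(n−1)}`** and **`Res(U_{n+1}, U_n) = (−1)^{n(n+1)∕2} 2^{n(n+1)}`** for Mathlib's `Polynomial.Chebyshev.T ∕ U` over `ℤ` (formal degrees `(n+1, n)`),
# and the LOWERING RELATION **`(1 − X²) U_{n+1}′ = (n+2) U_n − (n+1) X U_{n+1}`** (the `T` analogue is Mathlib's `one_sub_X_sq_mul_derivative_T_eq_poly_in_T`)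

HONEST FRAMING. Part of the Lean index of the computation cell `pub-hsemireg` (seat p10 gen 47, Sunday typer «UNIFORM-IN-n»).  Polynomial algebra over `ℤ` ∕ a commutative ring only (Mathlib
`Polynomial.resultant`, `Polynomial.Chebyshev`); no variety, no cohomology theory, no sheaf, no Ext group and no semiregularity map is constructed here; nothing here says that HC / HC_CM / HC_AV
holds; no Literature fact (unproved `Prop`) is declared or used.  Custodian versions as in `WedgeHankelSiegelIdeal` (1/3).
SOURCES (cited).  I. Schur, J. reine angew. Math. 165 (1931) 52–58, §1 (resultant of consecutive terms of a recurrence); K. Dilcher, K. B. Stolarsky, *Resultants and discriminants of Chebyshev and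
related polynomials*, Trans. Amer. Math. Soc. 357 (2005) 965–981, Thm 1 ∕ §2 (the values `Res(T_{n+1}, T_n)`, `Res(U_{n+1}, U_n)`); D. P. Jacobs, M. O. Rayes, V. Trevisan, *The resultant of Chebyshev
polynomials*, Canad. Math. Bull. 54 (2011) 288–296; T. J. Rivlin, *Chebyshev Polynomials* (2nd ed. 1990), §1.2 eq. (1.7) and p. 38 (`(1 − x²) U_n′ = −n x U_n + (n+1) U_{n−1}`).
PROOF TYPED HERE.  `T_{n+2} = (−1)·T_n + T_{n+1}·(2X)` ⇒ `Res_{(n+2,n+1)}(T_{n+2}, T_{n+1}) = Res_{(n+2,n+1)}(−T_n, T_{n+1}) = (lc T_{n+1})² · (−1)^{n+1} · Res_{(n,n+1)}(T_n, T_{n+1})` (Mathlib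
`resultant_add_mul_left`, `resultant_add_left_deg`, `resultant_C_mul_left`, `resultant_comm`), i.e. the step `× (−1)^{n+1} 4^n` (resp. `4^{n+1}` for `U`), and induction from `Res_{(1,0)} = 1`;
the `U` lowering relation from Mathlib `add_one_mul_T_eq_poly_in_U` and `T_eq_X_mul_U_sub_U`.  Degrees ∕ leading coefficients over `ℤ` from Mathlib `natDegree_T`, `leadingCoeff_T`,
`natDegree_U_natCast`, `leadingCoeff_U_natCast`; the value over any commutative ring by `map_T ∕ map_U` + `resultant_map_map`.
DEDUP DISCLOSURE (`rg -n -i 'chebyshev.*resultant|resultant.*chebyshev|T_resultant|U_resultant|derivative_U' Summits/Ventures/HSemireg Literature .lake/packages/mathlib/Mathlib/RingTheory/Polynomial`,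
2026-09-04): Mathlib has the second-derivative `U` identity (`one_sub_X_sq_mul_derivative_derivative_U_eq_poly_in_U`) but not the first-order lowering relation; no Chebyshev resultant anywhere;
0 hits for the 9 names below.

WHAT IS IN THE TREE.  N403 `prod_neg_pow_succ_eq` (not needed); Mathlib `Polynomial.Chebyshev.T_add_two ∕ U_add_two ∕ T_one ∕ U_one ∕ T_zero ∕ U_zero`, `natDegree_T`, `leadingCoeff_T`,
`natDegree_U_natCast`, `leadingCoeff_U_natCast`, `add_one_mul_T_eq_poly_in_U`, `T_eq_X_mul_U_sub_U`, `map_T`, `map_U`, `resultant_map_map`.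
THIS FILE (namespace `Summit.Ventures.HSemireg.Wedge.HankelOuter` continued; CHAINED on N405 (import only); 0 definitions):
* §1171 `chebyshevT_natDegree_coeff` ∕ `chebyshevU_natDegree_coeff` (`deg = n`, `[X^n] = 2^{n−1}` ∕ `2^n` over `ℤ`, `n ≥ 1` ∕ `n ≥ 0`), `chebyshevT_resultant_succ` ∕ `chebyshevU_resultant_succ`
  (Schur steps `× (−1)^{n+1} 4^n` ∕ `× (−1)^{n+1} 4^{n+1}`), **`chebyshevT_resultant`** (`Res_{(n+1,n)}(T_{n+1}, T_n) = (−1)^{n(n+1)∕2} 2^{n(n−1)}`), **`chebyshevU_resultant`**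
  (`Res_{(n+1,n)}(U_{n+1}, U_n) = (−1)^{n(n+1)∕2} 2^{n(n+1)}`), `chebyshevT_resultant_ring` ∕ `chebyshevU_resultant_ring` (any commutative ring), **`one_sub_X_sq_mul_derivative_U`**
  (`(1 − X²) U_{n+1}′ = (n+2) U_n − (n+1) X U_{n+1}`, any commutative ring).
CAVEATS.  `n(n−1)` is natural-number subtraction, harmless: at `n = 0` both sides are `1`.  Formal degrees explicit.  Nothing Ext-side.  New names only.
-/

open Module Polynomial
open scoped Matrix Polynomial

namespace Summit.Ventures.HSemireg.Wedge.HankelOuter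

/-! ## §1171. Resultants of consecutive Chebyshev polynomials -/

/-- Over `ℤ`: `deg T_{n+1} = n + 1` and `[X^{n+1}] T_{n+1} = 2^n`. [Mathlib `natDegree_T`, `leadingCoeff_T`; this file, §1171] -/
theorem chebyshevT_natDegree_coeff (n : ℕ) :
    (Polynomial.Chebyshev.T ℤ ((n : ℤ) + 1)).natDegree = n + 1 ∧ (Polynomial.Chebyshev.T ℤ ((n : ℤ) + 1)).coeff (n + 1) = 2 ^ n := by
  have hd : (Polynomial.Chebyshev.T ℤ ((n : ℤ) + 1)).natDegree = n + 1 := by rw [Polynomial.Chebyshev.natDegree_T]; omega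
  refine ⟨hd, ?_⟩
  have h := Polynomial.Chebyshev.leadingCoeff_T (R := ℤ) ((n : ℤ) + 1)
  rw [leadingCoeff, hd] at h
  rw [h, show ((n : ℤ) + 1).natAbs - 1 = n by omega]

/-- Over `ℤ`: `deg U_n = n` and `[X^n] U_n = 2^n`. [Mathlib `natDegree_U_natCast`, `leadingCoeff_U_natCast`; this file, §1171] -/
theorem chebyshevU_natDegree_coeff (n : ℕ) :
    (Polynomial.Chebyshev.U ℤ (n : ℤ)).natDegree = n ∧ (Polynomial.Chebyshev.U ℤ (n : ℤ)).coeff n = 2 ^ n := by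
  have hd : (Polynomial.Chebyshev.U ℤ (n : ℤ)).natDegree = n := Polynomial.Chebyshev.natDegree_U_natCast ℤ n
  refine ⟨hd, ?_⟩
  have h := Polynomial.Chebyshev.leadingCoeff_U_natCast ℤ n
  rw [leadingCoeff, hd] at h
  exact h

/-- **SCHUR'S STEP FOR `T`: `Res_{(n+2,n+1)}(T_{n+2}, T_{n+1}) = (−1)^{n+1} 4^n · Res_{(n+1,n)}(T_{n+1}, T_n)`** over `ℤ`. [Schur 1931 §1; Dilcher–Stolarsky 2005 §2; this file, §1171] -/
theorem chebyshevT_resultant_succ (n : ℕ) :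
    (Polynomial.Chebyshev.T ℤ ((n : ℤ) + 2)).resultant (Polynomial.Chebyshev.T ℤ ((n : ℤ) + 1)) (n + 2) (n + 1) =
      (-1) ^ (n + 1) * 4 ^ n * (Polynomial.Chebyshev.T ℤ ((n : ℤ) + 1)).resultant (Polynomial.Chebyshev.T ℤ (n : ℤ)) (n + 1) n := by
  obtain ⟨hd1, hc1⟩ := chebyshevT_natDegree_coeff n
  have hdn : (Polynomial.Chebyshev.T ℤ (n : ℤ)).natDegree ≤ n := by rw [Polynomial.Chebyshev.natDegree_T]; omega
  have h1 : Polynomial.Chebyshev.T ℤ ((n : ℤ) + 2) = C (-1 : ℤ) * Polynomial.Chebyshev.T ℤ (n : ℤ) + Polynomial.Chebyshev.T ℤ ((n : ℤ) + 1) * (2 * Polynomial.X) := by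
    rw [Polynomial.Chebyshev.T_add_two, map_neg, map_one]; ring
  have hdeg : (C (-1 : ℤ) * Polynomial.Chebyshev.T ℤ (n : ℤ)).natDegree ≤ n := (natDegree_C_mul_le _ _).trans hdn
  have h2X : (2 * Polynomial.X : ℤ[X]).natDegree ≤ 1 := by
    rw [show (2 : ℤ[X]) = C 2 by rw [map_ofNat]]; exact (natDegree_C_mul_le _ _).trans natDegree_X_le
  rw [h1, resultant_add_mul_left _ _ _ _ _ (by omega) hd1.le, resultant_add_left_deg _ _ n (n + 1) 2 hdeg, hc1, resultant_C_mul_left, resultant_comm _ _ n (n + 1),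
    Even.neg_one_pow (by rw [Nat.even_mul]; exact Or.inr (by decide)), Even.neg_one_pow (Nat.even_mul_succ_self n), one_mul, one_mul, ← pow_mul, show n * 2 = 2 * n by ring, pow_mul]
  norm_num
  ring

/-- **SCHUR'S STEP FOR `U`: `Res_{(n+2,n+1)}(U_{n+2}, U_{n+1}) = (−1)^{n+1} 4^{n+1} · Res_{(n+1,n)}(U_{n+1}, U_n)`** over `ℤ`. [Schur 1931 §1; Dilcher–Stolarsky 2005 §2; this file, §1171] -/
theorem chebyshevU_resultant_succ (n : ℕ) :
    (Polynomial.Chebyshev.U ℤ ((n : ℤ) + 2)).resultant (Polynomial.Chebyshev.U ℤ ((n : ℤ) + 1)) (n + 2) (n + 1) =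
      (-1) ^ (n + 1) * 4 ^ (n + 1) * (Polynomial.Chebyshev.U ℤ ((n : ℤ) + 1)).resultant (Polynomial.Chebyshev.U ℤ (n : ℤ)) (n + 1) n := by
  obtain ⟨hd1, hc1⟩ := chebyshevU_natDegree_coeff (n + 1)
  obtain ⟨hdn, -⟩ := chebyshevU_natDegree_coeff n
  push_cast at hd1 hc1
  have h1 : Polynomial.Chebyshev.U ℤ ((n : ℤ) + 2) = C (-1 : ℤ) * Polynomial.Chebyshev.U ℤ (n : ℤ) + Polynomial.Chebyshev.U ℤ ((n : ℤ) + 1) * (2 * Polynomial.X) := by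
    rw [Polynomial.Chebyshev.U_add_two, map_neg, map_one]; ring
  have hdeg : (C (-1 : ℤ) * Polynomial.Chebyshev.U ℤ (n : ℤ)).natDegree ≤ n := (natDegree_C_mul_le _ _).trans hdn.le
  have h2X : (2 * Polynomial.X : ℤ[X]).natDegree ≤ 1 := by
    rw [show (2 : ℤ[X]) = C 2 by rw [map_ofNat]]; exact (natDegree_C_mul_le _ _).trans natDegree_X_le
  rw [h1, resultant_add_mul_left _ _ _ _ _ (by omega) hd1.le, resultant_add_left_deg _ _ n (n + 1) 2 hdeg, hc1, resultant_C_mul_left, resultant_comm _ _ n (n + 1),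
    Even.neg_one_pow (by rw [Nat.even_mul]; exact Or.inr (by decide)), Even.neg_one_pow (Nat.even_mul_succ_self n), one_mul, one_mul, ← pow_mul, show (n + 1) * 2 = 2 * (n + 1) by ring,
    pow_mul]
  norm_num
  ring

/-- **`Res_{(n+1,n)}(T_{n+1}, T_n) = (−1)^{n(n+1)∕2} · 2^{n(n−1)}`** over `ℤ`. [Dilcher–Stolarsky 2005 Thm 1; Jacobs–Rayes–Trevisan 2011; this file, §1171] -/
theorem chebyshevT_resultant (n : ℕ) :
    (Polynomial.Chebyshev.T ℤ ((n : ℤ) + 1)).resultant (Polynomial.Chebyshev.T ℤ (n : ℤ)) (n + 1) n = (-1) ^ (n * (n + 1) / 2) * 2 ^ (n * (n - 1)) := by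
  induction n with
  | zero => simp [Polynomial.Chebyshev.T_zero]
  | succ n ih =>
    have h := chebyshevT_resultant_succ n
    have h2 : (n + 1) * (n + 1 + 1) = n * (n + 1) + 2 * (n + 1) := by ring
    have h3 : (n + 1) * (n + 1 - 1) = n * (n - 1) + 2 * n := by
      rcases n with _ | k
      · rfl
      · rw [Nat.add_sub_cancel, Nat.add_sub_cancel]; ring
    rw [Nat.cast_succ, show (n : ℤ) + 1 + 1 = (n : ℤ) + 2 by ring, h, ih, show (n + 1) * (n + 1 + 1) / 2 = n * (n + 1) / 2 + (n + 1) by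
      obtain ⟨c, hc⟩ := Nat.even_mul_succ_self n; omega, h3, show (4 : ℤ) ^ n = 2 ^ (2 * n) by rw [pow_mul]; norm_num]
    ring

/-- **`Res_{(n+1,n)}(U_{n+1}, U_n) = (−1)^{n(n+1)∕2} · 2^{n(n+1)}`** over `ℤ`. [Dilcher–Stolarsky 2005 Thm 1; this file, §1171] -/
theorem chebyshevU_resultant (n : ℕ) :
    (Polynomial.Chebyshev.U ℤ ((n : ℤ) + 1)).resultant (Polynomial.Chebyshev.U ℤ (n : ℤ)) (n + 1) n = (-1) ^ (n * (n + 1) / 2) * 2 ^ (n * (n + 1)) := by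
  induction n with
  | zero => simp [Polynomial.Chebyshev.U_zero]
  | succ n ih =>
    have h := chebyshevU_resultant_succ n
    have h2 : (n + 1) * (n + 1 + 1) = n * (n + 1) + 2 * (n + 1) := by ring
    rw [Nat.cast_succ, show (n : ℤ) + 1 + 1 = (n : ℤ) + 2 by ring, h, ih, show (n + 1) * (n + 1 + 1) / 2 = n * (n + 1) / 2 + (n + 1) by
      obtain ⟨c, hc⟩ := Nat.even_mul_succ_self n; omega, h2, show (4 : ℤ) ^ (n + 1) = 2 ^ (2 * (n + 1)) by rw [pow_mul]; norm_num]
    ring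

/-- `Res(T_{n+1}, T_n)` over ANY commutative ring (image of the integer value). [this file, §1171] -/
theorem chebyshevT_resultant_ring (R : Type*) [CommRing R] (n : ℕ) :
    (Polynomial.Chebyshev.T R ((n : ℤ) + 1)).resultant (Polynomial.Chebyshev.T R (n : ℤ)) (n + 1) n = (-1) ^ (n * (n + 1) / 2) * 2 ^ (n * (n - 1)) := by
  rw [← Polynomial.Chebyshev.map_T (Int.castRingHom R), ← Polynomial.Chebyshev.map_T (Int.castRingHom R), resultant_map_map, chebyshevT_resultant]
  simp

/-- `Res(U_{n+1}, U_n)` over ANY commutative ring. [this file, §1171] -/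
theorem chebyshevU_resultant_ring (R : Type*) [CommRing R] (n : ℕ) :
    (Polynomial.Chebyshev.U R ((n : ℤ) + 1)).resultant (Polynomial.Chebyshev.U R (n : ℤ)) (n + 1) n = (-1) ^ (n * (n + 1) / 2) * 2 ^ (n * (n + 1)) := by
  rw [← Polynomial.Chebyshev.map_U (Int.castRingHom R), ← Polynomial.Chebyshev.map_U (Int.castRingHom R), resultant_map_map, chebyshevU_resultant]
  simp

/-- **THE LOWERING RELATION FOR `U`: `(1 − X²) U_{n+1}′ = (n + 2) U_n − (n + 1) X U_{n+1}`** over any commutative ring (Mathlib has the `T` analogue). [Rivlin §1.2 (1.7), p. 38; Szegő (4.7.27)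
at `λ = 1`; this file, §1171] -/
theorem one_sub_X_sq_mul_derivative_U (R : Type*) [CommRing R] (n : ℤ) :
    (1 - Polynomial.X ^ 2) * derivative (Polynomial.Chebyshev.U R (n + 1)) =
      ((n : R[X]) + 2) * Polynomial.Chebyshev.U R n - ((n : R[X]) + 1) * Polynomial.X * Polynomial.Chebyshev.U R (n + 1) := by
  have h1 := Polynomial.Chebyshev.add_one_mul_T_eq_poly_in_U (R := R) (n + 1)
  have h2 := Polynomial.Chebyshev.T_eq_X_mul_U_sub_U (R := R) n
  rw [show n + 1 + 1 = n + 2 by ring] at h1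
  linear_combination (norm := (push_cast; ring_nf)) h1 - ((n : R[X]) + 2) * h2

end Summit.Ventures.HSemireg.Wedge.HankelOuter
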